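import Summits.MatrixMultiplication.OmegaCensus.SmallFormats.InvertiblePointDeltaLawPrep
import Summits.MatrixMultiplication.OmegaCensus.SmallFormats.KroneckerMain
import HarnessLib

/-!
# ω-census family (a): the δ-law's BLOCK DATA at a saturated point, packaged once (for all forms of the law)

Cell `pub-omega` (unit `pub-omega-tensor`, gen 34), topic `Summits/MatrixMultiplication/OmegaCensus` (sub-folder
`SmallFormats`). Framing (verbatim): lottery ticket; floor = certified bounds/negative ranges. HONEST FRAMING: a refactoring with
no new mathematics — steps 0–6 of `InvertiblePointDeltaLaw` / `InvertiblePointDeltaLawTwo` exported as ONE existential statement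
(`exists_saturated_blockData`), so that further forms of the law (`InvertiblePointDeltaLawThree`, …) do not repeat them. At a
saturated `X₀ = 1` (`|O| = 2n`) there are: Weierstraß–Kronecker blocks `blk i` (g33's `kronecker_blockDecomposition` of the span of
the vanishing terms' outputs), a column basis `bF` of `kⁿ` indexed by the block columns, block matrices `M i` reading the block
coordinates of the rows, such that (1) `(W·M i)_{s,c}` is the `⟨i,c⟩`-coordinate of row `s`; (2) the `M i` are jointly injective;
(3) no block is of type `L_ε`; (4) `dim (K₀·M i) ≤ δ(blk i)` for the common kernel `K₀` of the vanishing terms' forms (δ-table);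
(5) `2n ≤ dim K₀ + (|ι| − |O|)`; (6) `Σ rows + |O| ≤ |ι|`, `Σ cols = n`. Nothing on `ω`.
-/

namespace Summit.MatrixMultiplication.OmegaCensus.SmallFormats

open Module Submodule Matrix Kronecker Kronecker.KBlock DeltaBlocks Literature.Computability.AlgebraicComplexity

namespace DeltaLaw

variable {k : Type*} [Field k] {n : ℕ} {ι : Type*} [Fintype ι] [DecidableEq ι]

/-- **Block data at a saturated point** (see the module docstring for the six conjuncts). -/
theorem exists_saturated_blockData (β : BilinComp (mulBilin k 2 2 n) ι) (O : Finset ι)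
    (hO : ∀ i, i ∉ O → β.f i 1 = 0) (hO' : ∀ i ∈ O, β.f i 1 ≠ 0) (hcard : O.card = 2 * n) :
    ∃ (N : ℕ) (blk : Fin N → KBlock k) (bF : Basis (Σ i : Fin N, Fin (blk i).cols) k (Fin n → k))
      (M : ∀ i : Fin N, Matrix (Fin n) (Fin (blk i).cols) k),
      (∀ (i : Fin N) (W : Matrix (Fin 2) (Fin n) k) (s : Fin 2) (c : Fin (blk i).cols),
          (W * M i) s c = bF.coord ⟨i, c⟩ (W s)) ∧
      (∀ W : Matrix (Fin 2) (Fin n) k, (∀ i, W * M i = 0) → W = 0) ∧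
      (∀ (i : Fin N) (e : ℕ), blk i ≠ KBlock.L e) ∧
      (∀ i : Fin N, finrank k ↥((LinearMap.ker (LinearMap.pi fun t : ↥(Finset.univ \ O) => β.g (t : ι))).map
          ((mulBilin k 2 n (blk i).cols).flip (M i))) ≤ (blk i).delta) ∧
      2 * n ≤ finrank k ↥(LinearMap.ker (LinearMap.pi fun t : ↥(Finset.univ \ O) => β.g (t : ι))) +
          (Fintype.card ι - O.card) ∧
      ∑ i, (blk i).rows + O.card ≤ Fintype.card ι ∧ ∑ i, (blk i).cols = n := by
  classical
  set Zs : Finset ι := Finset.univ \ O with hZs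
  have hZcard : Zs.card = Fintype.card ι - O.card := by
    rw [hZs, Finset.card_sdiff, Finset.inter_univ, Finset.card_univ]
  have hOle : O.card ≤ Fintype.card ι := Finset.card_le_univ O
  set 𝒲 : Submodule k (Matrix (Fin 2) (Fin n) k) := Submodule.span k (Set.range fun t : Zs => β.w (t : ι)) with h𝒲
  have h𝒲dim : finrank k 𝒲 ≤ Fintype.card ι - O.card := by
    rw [← hZcard, ← Fintype.card_coe Zs]; exact finrank_range_le_card _
  have hwmem : ∀ t, t ∉ O → β.w t ∈ 𝒲 := fun t ht =>
    Submodule.subset_span ⟨⟨t, Finset.mem_sdiff.mpr ⟨Finset.mem_univ t, ht⟩⟩, rfl⟩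
  let a : 𝒲 →ₗ[k] (Fin n → k) := (rowLM n 0).comp 𝒲.subtype
  let b : 𝒲 →ₗ[k] (Fin n → k) := (rowLM n 1).comp 𝒲.subtype
  have hab : ∀ u : 𝒲, ∀ s : Fin 2, (u : Matrix (Fin 2) (Fin n) k) s = if s = 0 then a u else b u := by
    intro u s; fin_cases s <;> rfl
  obtain ⟨N, blk, e, f, D, -⟩ := kronecker_blockDecomposition a b
  let J := Σ i : Fin N, Fin (blk i).cols
  let F : J → (Fin n → k) := fun p => f p.1 p.2
  have hFspan : ⊤ ≤ Submodule.span k (Set.range F) := by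
    rintro v -
    obtain ⟨g, hg⟩ := D.span_f v
    rw [hg]
    exact Submodule.sum_mem _ fun i _ => Submodule.sum_mem _ fun c hc =>
      Submodule.smul_mem _ _ (Submodule.subset_span ⟨⟨i, ⟨c, Finset.mem_range.mp hc⟩⟩, rfl⟩)
  have hnfin : finrank k (Fin n → k) = n := Module.finrank_fin_fun k
  have hFcard : Fintype.card J = finrank k (Fin n → k) := by
    rw [Fintype.card_sigma, ← D.cols_eq]; simp
  let bF := basisOfTopLeSpanOfCardEqFinrank F hFspan hFcard
  have hbF : ∀ p, bF p = F p := fun p => by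
    simp [bF, coe_basisOfTopLeSpanOfCardEqFinrank]
  have hcoordf : ∀ (p : J) (i : Fin N) (c : ℕ) (hc : c < (blk i).cols),
      bF.coord p (f i c) = if (⟨i, ⟨c, hc⟩⟩ : J) = p then 1 else 0 := by
    intro p i c hc
    have : f i c = bF ⟨i, ⟨c, hc⟩⟩ := by rw [hbF]
    rw [this, Basis.coord_apply, Basis.repr_self, Finsupp.single_apply]
  let M : ∀ i : Fin N, Matrix (Fin n) (Fin (blk i).cols) k := fun i j c => bF.coord ⟨i, c⟩ (Pi.single j 1)
  have hMapply : ∀ i (W : Matrix (Fin 2) (Fin n) k) (s : Fin 2) (c : Fin (blk i).cols),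
      (W * M i) s c = bF.coord ⟨i, c⟩ (W s) := by
    intro i W s c
    rw [Matrix.mul_apply]
    conv_rhs => rw [eq_sum_smul_single (W s), map_sum]
    refine Finset.sum_congr rfl fun j _ => ?_
    rw [map_smul, smul_eq_mul]
  have hM : ∀ W : Matrix (Fin 2) (Fin n) k, (∀ i, W * M i = 0) → W = 0 := by
    intro W hW
    ext s j
    have hz : W s = 0 := by
      refine (bF.forall_coord_eq_zero_iff).mp fun p => ?_
      obtain ⟨i, c⟩ := p
      rw [← hMapply i W s c, hW i, Matrix.zero_apply]
    rw [hz]; rfl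
  have heM : ∀ (i b' : Fin N) (r : ℕ) (hr : r < (blk i).rows),
      ((e i r : Matrix (Fin 2) (Fin n) k) * M b') = if h : i = b' then h ▸ (blk i).gen r else 0 := by
    intro i b' r hr
    ext s c
    rw [hMapply, hab]
    have hA := D.rel_a i r hr
    have hB := D.rel_b i r hr
    by_cases hib : i = b'
    · subst hib
      rw [dif_pos rfl]
      have key : ∀ G : ℕ → ℕ → k,
          bF.coord ⟨i, c⟩ (∑ c' ∈ Finset.range (blk i).cols, G r c' • f i c') = G r c := by
        intro G
        rw [map_sum, Finset.sum_eq_single_of_mem (c : ℕ) (Finset.mem_range.mpr c.2)]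
        · rw [map_smul, hcoordf _ i c c.2, if_pos rfl, smul_eq_mul, mul_one]
        · intro c' hc' hne
          rw [map_smul, hcoordf _ i c' (Finset.mem_range.mp hc'), if_neg, smul_zero]
          intro h; apply hne
          have := congrArg (fun q : J => (q.2 : ℕ)) h
          simpa using this
      fin_cases s
      · simp only [Fin.zero_eta, Fin.isValue, ↓reduceIte]; rw [hA, gen_zero_apply]; exact key _
      · simp only [Fin.mk_one, Fin.isValue, one_ne_zero, ↓reduceIte]; rw [hB, gen_one_apply]; exact key _
    · rw [dif_neg hib, Matrix.zero_apply]
      have key : ∀ (G : ℕ → ℕ → k), bF.coord ⟨b', c⟩ (∑ c' ∈ Finset.range (blk i).cols, G r c' • f i c') = 0 := by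
        intro G
        rw [map_sum]
        refine Finset.sum_eq_zero fun c' hc' => ?_
        rw [map_smul, hcoordf _ i c' (Finset.mem_range.mp hc'), if_neg, smul_zero]
        intro h
        exact hib (congrArg Sigma.fst h)
      fin_cases s
      · simp only [Fin.zero_eta, Fin.isValue, ↓reduceIte]; rw [hA]; exact key _
      · simp only [Fin.mk_one, Fin.isValue, one_ne_zero, ↓reduceIte]; rw [hB]; exact key _
  have hWM : ∀ (u : 𝒲) (b' : Fin N), (u : Matrix (Fin 2) (Fin n) k) * M b' ∈ (blk b').space := by
    intro u b'
    obtain ⟨g, hg⟩ := D.span_e u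
    have hu : (u : Matrix (Fin 2) (Fin n) k) =
        ∑ i, ∑ r ∈ Finset.range (blk i).rows, g i r • (e i r : Matrix (Fin 2) (Fin n) k) := by
      conv_lhs => rw [hg]
      rw [Submodule.coe_sum]
      refine Finset.sum_congr rfl fun i _ => ?_
      rw [Submodule.coe_sum]
      refine Finset.sum_congr rfl fun r _ => ?_
      rw [Submodule.coe_smul]
    rw [hu, Matrix.sum_mul]
    refine Submodule.sum_mem _ fun i _ => ?_
    rw [Matrix.sum_mul]
    refine Submodule.sum_mem _ fun r hr => ?_
    rw [Matrix.smul_mul]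
    refine Submodule.smul_mem _ _ ?_
    rw [heM i b' r (Finset.mem_range.mp hr)]
    by_cases hib : i = b'
    · subst hib
      rw [dif_pos rfl]
      exact Submodule.subset_span ⟨⟨r, Finset.mem_range.mp hr⟩, rfl⟩
    · rw [dif_neg hib]; exact Submodule.zero_mem _
  have hS : ∀ (b' : Fin N) (t : ι), t ∉ O → β.w t * M b' ∈ (blk b').space := fun b' t ht =>
    hWM ⟨β.w t, hwmem t ht⟩ b'
  have hsurj : ∀ (b' : Fin N) (B' : Matrix (Fin 2) (Fin (blk b').cols) k),
      ∃ W : Matrix (Fin 2) (Fin n) k, W * M b' = B' := by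
    intro b' B'
    refine ⟨fun s => ∑ c, B' s c • f b' c, ?_⟩
    ext s c
    rw [hMapply, map_sum]
    simp_rw [map_smul]
    rw [Finset.sum_eq_single c]
    · rw [hcoordf _ b' c c.2, if_pos rfl, smul_eq_mul, mul_one]
    · intro c' _ hne
      rw [hcoordf _ b' c' c'.2, if_neg, smul_zero]
      intro h; apply hne
      have := congrArg (fun q : J => (q.2 : ℕ)) h
      exact Fin.ext (by simpa using this)
    · intro h; exact absurd (Finset.mem_univ c) h
  have noL : ∀ (b' : Fin N) (e' : ℕ), blk b' ≠ KBlock.L e' := by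
    intro b'
    refine ne_L_of_footprints (blk b') (Set.range fun s : O => β.w (s : ι) * M b') ?_ ?_
    · -- spanning
      rintro B' -
      obtain ⟨W, hW⟩ := hsurj b' B'
      have hWspan : W ∈ Submodule.span k (Set.range fun i : O => β.w (i : ι)) :=
        top_le_span_w_off β 1 isUnit_det_one_fin_two O hO Submodule.mem_top
      rw [← hW]
      refine Submodule.span_induction (p := fun W _ => W * M b' ∈ Submodule.span k
          (Set.range fun s : O => β.w (s : ι) * M b')) ?_ ?_ ?_ ?_ hWspan
      · rintro _ ⟨s, rfl⟩; exact Submodule.subset_span ⟨s, rfl⟩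
      · rw [Matrix.zero_mul]; exact Submodule.zero_mem _
      · intro x y _ _ hx hy; rw [Matrix.add_mul]; exact Submodule.add_mem _ hx hy
      · intro c x _ hx; rw [Matrix.smul_mul]; exact Submodule.smul_mem _ _ hx
    · rintro _ ⟨s, rfl⟩
      exact ⟨β.f s, hO' s s.2, fun X => block_footprint_mem β O hO hO' hcard (M b') _ (hS b') s.2 X⟩
  set K₀ := LinearMap.ker (LinearMap.pi fun t : ↥(Finset.univ \ O) => β.g (t : ι)) with hK₀
  have memK₀ : ∀ W, W ∈ K₀ ↔ ∀ t, t ∉ O → β.g t W = 0 := fun W => by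
    rw [hK₀, LinearMap.mem_ker]
    constructor
    · intro h t ht
      have := congr_fun h ⟨t, Finset.mem_sdiff.mpr ⟨Finset.mem_univ t, ht⟩⟩
      simpa using this
    · intro h; funext t; simpa using h t (Finset.mem_sdiff.mp t.2).2
  have hdimK : 2 * n ≤ finrank k K₀ + (Fintype.card ι - O.card) := by
    have h1 := LinearMap.finrank_range_add_finrank_ker (LinearMap.pi fun t : ↥(Finset.univ \ O) => β.g (t : ι))
    rw [finrank_matrix_fin, ← hK₀] at h1
    have h2 : finrank k (LinearMap.range (LinearMap.pi fun t : ↥(Finset.univ \ O) => β.g (t : ι))) ≤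
        Fintype.card ι - O.card := by
      calc finrank k (LinearMap.range (LinearMap.pi fun t : ↥(Finset.univ \ O) => β.g (t : ι)))
          ≤ finrank k (↥(Finset.univ \ O) → k) := Submodule.finrank_le _
        _ = Fintype.card ι - O.card := by
            rw [finrank_fintype_fun_eq_card, Fintype.card_coe, ← hZs, hZcard]
    omega
  let π : ∀ i : Fin N, Matrix (Fin 2) (Fin n) k →ₗ[k] Matrix (Fin 2) (Fin (blk i).cols) k :=
    fun i => (mulBilin k 2 n (blk i).cols).flip (M i)
  have hπ : ∀ i W, π i W = W * M i := fun i W => by simp [π, LinearMap.flip_apply, mulBilin_apply]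
  have hδ : ∀ i, finrank k (K₀.map (π i)) ≤ (blk i).delta := fun i =>
    (finrank_block_map_ker_le β O hO hO' hcard (M i) _ (hS i)).trans
      (finrank_inf_le_delta (blk i) (span_off_le_deltaSpan β.f O hO' _))
  have hrows : ∑ i, (blk i).rows = finrank k 𝒲 := D.rows_eq
  have hcols : ∑ i, (blk i).cols = n := by rw [D.cols_eq, hnfin]
  exact ⟨N, blk, bF, M, hMapply, hM, noL, hδ, hdimK, by omega, hcols⟩

end DeltaLaw

end Summit.MatrixMultiplication.OmegaCensus.SmallFormats
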